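import Literature.MathematicalPhysics.QuantumFieldTheory.Balaban1983to89.B7Eq44TorusAxialGaugeLocal

/-!
# `Balaban1983to89.B9Eq335SmallPlaquettesLocalData` — T. Bałaban, *Propagators for lattice gauge theories in a background field*, Commun. Math. Phys.
# **99** (1985) 389–434 [Balaban1985BackgroundPropagators] (3.35) p. 396 (the class: on every cube a gauge with `U^u = e^{iηA}`, `A` small) with
# [Balaban1985Averaging] (42) p. 23, (44) p. 24, p. 25 («Let us notice that it is a local result; the bound above depends on bounds for V(∂p) − 1 on
# Δ(p′)»): **E162's REGULARITY DATUM `hreg` OF THE CHAIN's `Q(U)` READ OFF THE PLAQUETTES, BLOCK BY BLOCK, WITH A VOLUME-FREE CONSTANT — for a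
# unit-bounded torus field whose plaquette variables are `δ`-close to `1`, EVERY block contour holonomy `W_{c,x}(Ũ)` (corner `L·y`, direction `κ`, offset
# `r ∈ [0, L)^d`) satisfies `‖W_{c,x}(Ũ) − 1‖ ≤ L·δ·Σ_{κ′≠κ} r_{κ′} ≤ L(d−1)(L−1)·δ`** — [folklore] composition BY NAME of ne9-leaf-03's box transfer
# `B7Eq44TorusAxialGaugeLocal.plaqSmall_perCfg_box` with the tree's SHARP local non-abelian Stokes `B8Lemma1NonAbelian.norm_Wcx_sub_one_le_sharp` on the box
# `L·y + [0, pairTop]` of ONE block contour (no wrap once `m_i ≥ 2`); route R2′ STEP B8′, instance-ledger rows L5 ∕ L10 of the pub-balaban NE9 chain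
# (`t4/ROUTES-NE9.md` v13.46): the `Q`-data of a background of the (3.35) class (small plaquettes, NOT small bonds) — the sibling `B9Thm311SmallPlaquettes.
# hreg_of_small_plaquettes` goes through a GLOBAL axial gauge and carries the lattice size `N` and the closed coordinate lines; this one is local

statement-level skeleton of published theorems with citation tags; proofs where landed; nothing here is a claim about the Yang–Mills mass gap

CITATION HEADER (lean-in-tree rule).  Audit cell `pub-balaban`, sub-cell `t4`, BINDER row NE9; filed by NE9 formalisation-swarm LEAF PROVER 05
(`b2b-balaban-t4-ne9-formalise-leaf-05`, gen 79).  [folklore] finite bookkeeping over two tree theorems used BY NAME: `plaqSmall_perCfg_box` ([B7] (44) on a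
non-wrapping box of the torus ⇒ the `ℤ^d` predicate `PlaqSmall` for the periodic extension) and `norm_Wcx_sub_one_le_sharp` ([B7] p. 25 l. 3 / [B8] Lemma 1:
`‖W_{c,x} − 1‖ ≤ L·a·Σ_{κ′≠κ} r_{κ′}` from `PlaqSmall` on `[y, y + pairTop]`).  Source READ in the held text [Balaban1985BackgroundPropagators] (journal page = PDF
page + 388): p. 396 (3.35); [Balaban1985Averaging] pp. 23–25 ((42) the contours `Γ^c_{y,x}`, (44) the plaquette hypothesis, p. 25 the locality remark quoted
above).  NOTHING of print's estimates is asserted beyond these two tree theorems' conclusions.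

WHY (rows L5 ∕ L10, the (3.35) class).  The chain's block averaging `Q(U) = B9Eq315QTorus.QtorusW L m hL φ U hα1 hU1 hreg` is DEFINED only on backgrounds
carrying E162's data: `hU1` (unit-bounded periodic extension), `hreg` (every block contour holonomy `α`-close to `1`) and `hα1 : α ≤ 1∕64`.  For a background
of the (3.35) class — small PLAQUETTES everywhere, bond variables NOT near `1` — the (3.26)-currency estimate of the per-cube reduction
(`B9Eq387CubeReductionSmallField`, `B9Eq315QTorusLocality.norm_QtorusW_gauge_transfer`: letters `hα1 hU1 hreg` AT `U`) needs these data AT `U` itself, uniformly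
in the volume.  `B9Eq335SmallBondsData.hreg_of_small_bonds` serves small-BOND fields (the auxiliary `Ũ`); `B9Thm311SmallPlaquettes.hreg_of_small_plaquettes`
serves small plaquettes but through the GLOBAL gauge (`N ≥ L·m_i`, closed lines `θ`).  This file is the LOCAL reading print points at (p. 25): one block
contour sees only the plaquettes of its own `L × 2L` box.

WHAT IS PROVED (sorry-free; proof lane — no `def`, no `Prop` placeholder; [folklore]).
* §1 PRINT's LOCAL RESULT (the plaquettes OF THE CONTOUR's BOX only; the box must not wrap: `2 ≤ m_i`): `liftSite_centre_eq_cornerSite` (`(L·y)~ = L·ỹ`),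
  `pairTop_add_one_le`, **`plaqSmall_perCfg_blockBox`** (`PlaqSmall (perCfg U) (L·y) (L·y + pairTop L κ) δ` from the box's torus plaquettes —
  ne9-leaf-03's `plaqSmall_perCfg_box`), **`hreg_of_small_plaquettes_box`** (`‖W_{c,x}(Ũ) − 1‖ ≤ L·δ·offDiag κ r` from the box's plaquettes).
* §2 THE (3.35) CLASS AT ONE LEVEL (ALL plaquettes `δ`-close; NO wrap condition — `plaqSmall_perCfg'`): **`hreg_of_small_plaquettes_local`**
  (`≤ L·δ·offDiag κ r`), **`hreg_of_small_plaquettes_local'`** (`≤ L((d−1)(L−1))·δ` — E162's `hreg` with `α := L(d−1)(L−1)·δ`, VOLUME-FREE),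
  `alpha_le_64_of_le` (E162's `hα1`: `α ≤ 1∕64` once `δ ≤ 1∕(64(L((d−1)(L−1)) + 1))`).
MODEL ∕ DECLARED READINGS.  (M1) the chain's encodings verbatim (`TSite`, `Bond`, `perCfg`, `cornerSite`, `Wcx`, `boxVec`, `pairTop`, `offDiag`, `plaqHolU`, `U1`);
(M2) hypotheses: `U(b) ∈ U1`; §1 the plaquettes of ONE box (print's local form, `2 ≤ m_i` so that the `L × … × 2L` box does not wrap), §2 ALL
plaquettes of the torus (then no wrap condition: the periodic extension is `PlaqSmall` on every interval); (M3) constants explicit.  NOT HERE: `Q(U)` itself, any window.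
HONEST SCOPE.  [folklore] bookkeeping BY NAME; NOT (loc), NOT Tier P, NOT NE9 (cell pub-balaban: NE9 NOT PRINTED ∕ NOT PROVED; «NE9 ⇐ the named binders»; row
WALLED ON A MODEL (O-NE9-1; #5 UNRULED); spine PROVED 0∕9; rung (B)+1 on a finite T⁴ — NOT infinite volume, NOT mass gap, NOT BetaPertH, NOT Clay; HONEST
DEPENDENCY: continuum YM on T⁴ ⇐ BetaPertH ∧ nine spine estimates (0/9 proved); BetaPertH ⇐ (D1) ∧ (D4) ∧ CAP+tail; G-an2-4 gates asym, D1 and NE2/3/4).  NEW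
file; imports `B7Eq44TorusAxialGaugeLocal` only; nothing modified.  Net new unproved facts: 0.
-/

noncomputable section

set_option autoImplicit false

namespace Literature.MathematicalPhysics.QuantumFieldTheory.Balaban1983to89.B9Eq335SmallPlaquettesLocalData

open B4Sect5Torus (TSite)
open B9SectCLatticeCarrier (Bond)
open B7Prop1Explicit (U1 Wcx boxVec e)
open B8Lemma1NonAbelian (pairTop offDiag offDiag_le norm_Wcx_sub_one_le_sharp)
open B9Eq315QTorus (perSite perCfg perCfg_apply cornerSite)
open B9Eq315QTorusOnto (liftSite)
open B9Eq310DeltaPrime (plaqHolU)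
open B9Eq319QprimeTorus (fineP centre centre_apply_val)
open B7Eq44TorusAxialGaugeLocal (plaqSmall_perCfg_box)
open B7Eq44TorusAxialGauge (plaqSmall_perCfg')

variable {d : ℕ} (L : ℕ) [NeZero L] (m : Fin d → ℕ) [∀ i, NeZero (fineP L m i)]
  {𝔸 : Type*} [NormedRing 𝔸] [NormOneClass 𝔸] {U : Bond d (fineP L m) → 𝔸ˣ} (hU : ∀ b, U b ∈ U1 𝔸)
  (hm : ∀ i, 2 ≤ m i) {δ : ℝ}
  -- print's LOCAL hypothesis: the plaquettes OF THE BOX of one block contour (corner `L·y`, extents `pairTop L κ`)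
  {y : TSite d m} {κ : Fin d}
  (hδbox : ∀ (x : TSite d (fineP L m)) (κ' μ : Fin d) (hκμ : κ' < μ), liftSite (x - centre L m y) + e κ' + e μ ≤ pairTop L κ →
    ‖(plaqHolU U (x, ⟨(κ', μ), hκμ⟩) : 𝔸) - 1‖ ≤ δ)
  -- the GLOBAL hypothesis of the (3.35) class at one level
  (hδ : ∀ p : B9SectCLatticeCarrier.Plaq d (fineP L m), ‖(plaqHolU U p : 𝔸) - 1‖ ≤ δ)

/-! ## §1 The box of one block contour inside the torus -/

omit [∀ i, NeZero (fineP L m i)] in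
/-- `(L·y)~ = L·ỹ`: the fine corner of the block `B(y)` lifts to `cornerSite L y` (no wrap: `L·y_i < L·m_i`). [cite: Balaban1985Averaging, (2) p.17] -/
theorem liftSite_centre_eq_cornerSite (y : TSite d m) : liftSite (centre L m y) = cornerSite L y := by
  funext i
  simp only [liftSite, cornerSite, centre_apply_val]
  push_cast
  ring

omit [∀ i, NeZero (fineP L m i)] in
include hm in
/-- The box `L·y + [0, pairTop L κ]` of one block contour (`2L − 1` along `κ`, `L − 1` across) does not wrap once `2 ≤ m_i`:
`pairTop L κ i + 1 ≤ L·m_i`. [cite: Balaban1985Averaging, (42) p.23] -/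
theorem pairTop_add_one_le (κ i : Fin d) : pairTop L κ i + 1 ≤ (fineP L m i : ℕ) := by
  have hL : (1 : ℤ) ≤ L := by exact_mod_cast Nat.one_le_iff_ne_zero.mpr (NeZero.ne L)
  have h2 : (2 : ℤ) ≤ m i := by exact_mod_cast hm i
  have hP : ((fineP L m i : ℕ) : ℤ) = (L : ℤ) * (m i : ℤ) := by simp only [fineP]; push_cast; ring
  rw [hP]
  simp only [pairTop]
  split_ifs <;> nlinarith

include hU hm hδbox in
/-- **(44) ON THE BOX OF ONE BLOCK CONTOUR ⇒ `PlaqSmall` THERE** (print's LOCAL hypothesis: only the plaquettes with corners in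
`[L·y, L·y + pairTop L κ]` are assumed `δ`-close): the periodic extension of `U` is `PlaqSmall` on that box — ne9-leaf-03's `plaqSmall_perCfg_box` BY NAME
(the box does not wrap: `2 ≤ m_i`). [cite: Balaban1985Averaging, (44) p.24, (42) p.23, p.25; Balaban1985BackgroundPropagators, (3.35) p.396] -/
theorem plaqSmall_perCfg_blockBox :
    B8Lemma1NonAbelian.PlaqSmall (perCfg (fineP L m) U) (cornerSite L y) (cornerSite L y + pairTop L κ) δ := by
  rw [← liftSite_centre_eq_cornerSite L m y]
  exact plaqSmall_perCfg_box (fineP L m) hU (centre L m y) (pairTop_add_one_le L m hm κ) hδbox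

include hU hm hδbox in
/-- **`hreg` FROM THE PLAQUETTES OF THE CONTOUR's OWN BOX — PRINT's «LOCAL RESULT»** ([B7] p. 25): `‖W_{c,x}(Ũ) − 1‖ ≤ L·δ·Σ_{κ′≠κ} r_{κ′}` for the
block corner `y`, direction `κ` and every offset `r`, assuming ONLY the plaquettes of the box `[L·y, L·y + pairTop L κ]` `δ`-close.
[cite: Balaban1985Averaging, p.25 «the bound above depends on bounds for V(∂p) − 1 on Δ(p′)», (42) p.23, (44) p.24; Balaban1985BackgroundPropagators, (3.35) p.396] -/
theorem hreg_of_small_plaquettes_box (r : Fin d → Fin L) :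
    ‖((Wcx L (perCfg (fineP L m) U) (cornerSite L y) κ (boxVec L r) : 𝔸ˣ) : 𝔸) - 1‖ ≤ (L : ℝ) * δ * offDiag κ r :=
  norm_Wcx_sub_one_le_sharp L (perCfg (fineP L m) U) (fun x κ => by rw [perCfg_apply]; exact hU _)
    (plaqSmall_perCfg_blockBox L m hU hm hδbox) (cornerSite L y) κ le_rfl le_rfl r

/-! ## §2 E162's `hreg` from the plaquettes, block by block -/

omit [NeZero L] in
include hU hδ in
/-- **`hreg` OF THE (3.35) CLASS AT ONE LEVEL, SHARP AND VOLUME-FREE**: if ALL plaquette variables of the torus are `δ`-close to `1`, then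
`‖W_{c,x}(Ũ) − 1‖ ≤ L·δ·Σ_{κ′≠κ} r_{κ′}` for every block corner `y`, direction `κ`, offset `r` — the periodic extension is `PlaqSmall` on EVERY order
interval (`B7Eq44TorusAxialGauge.plaqSmall_perCfg'`, no wrap condition), then the sharp local Stokes. [cite: Balaban1985Averaging, p.25, (42) p.23, (44) p.24; Balaban1985BackgroundPropagators, (3.35) p.396] -/
theorem hreg_of_small_plaquettes_local (y : TSite d m) (κ : Fin d) (r : Fin d → Fin L) :
    ‖((Wcx L (perCfg (fineP L m) U) (cornerSite L y) κ (boxVec L r) : 𝔸ˣ) : 𝔸) - 1‖ ≤ (L : ℝ) * δ * offDiag κ r :=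
  norm_Wcx_sub_one_le_sharp L (perCfg (fineP L m) U) (fun x κ => by rw [perCfg_apply]; exact hU _)
    (plaqSmall_perCfg' (fineP L m) hU hδ (cornerSite L y) (cornerSite L y + pairTop L κ)) (cornerSite L y) κ le_rfl le_rfl r

omit [NeZero L] in
include hU hδ in
/-- **THE UNIFORM FORM — E162's `hreg` with `α := L·((d−1)(L−1))·δ`, VOLUME-FREE, NO WRAP CONDITION** (needs `0 ≤ δ`):
`‖W_{c,x}(Ũ) − 1‖ ≤ L((d−1)(L−1))·δ`. [cite: Balaban1985Averaging, p.25; Balaban1985BackgroundPropagators, (3.35) p.396] -/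
theorem hreg_of_small_plaquettes_local' (hδ0 : 0 ≤ δ) (y : TSite d m) (κ : Fin d) (r : Fin d → Fin L) :
    ‖((Wcx L (perCfg (fineP L m) U) (cornerSite L y) κ (boxVec L r) : 𝔸ˣ) : 𝔸) - 1‖ ≤ (L : ℝ) * (((d : ℝ) - 1) * ((L : ℝ) - 1)) * δ := by
  refine (hreg_of_small_plaquettes_local L m hU hδ y κ r).trans ?_
  have h := offDiag_le κ r
  have hL0 : (0 : ℝ) ≤ L := Nat.cast_nonneg _
  calc (L : ℝ) * δ * offDiag κ r ≤ (L : ℝ) * δ * (((d : ℝ) - 1) * ((L : ℝ) - 1)) :=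
        mul_le_mul_of_nonneg_left h (mul_nonneg hL0 hδ0)
    _ = (L : ℝ) * (((d : ℝ) - 1) * ((L : ℝ) - 1)) * δ := by ring

omit [NeZero L] in
/-- **E162's `hα1` FOR THAT `α`**: `L((d−1)(L−1))·δ ≤ 1∕64` once `δ ≤ 1∕(64·(L((d−1)(L−1)) + 1))` (`1 ≤ L`, `1 ≤ d`). [folklore]
[cite: Balaban1985Averaging, p.37 «α sufficiently small»; Balaban1985BackgroundPropagators, (3.35) p.396] -/
theorem alpha_le_64_of_le (hL : 1 ≤ L) (hd : 1 ≤ d) {δ' : ℝ}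
    (hδr : δ' ≤ 1 / (64 * ((L : ℝ) * (((d : ℝ) - 1) * ((L : ℝ) - 1)) + 1))) :
    (L : ℝ) * (((d : ℝ) - 1) * ((L : ℝ) - 1)) * δ' ≤ 1 / 64 := by
  have hL' : (1 : ℝ) ≤ L := by exact_mod_cast hL
  have hd' : (1 : ℝ) ≤ d := by exact_mod_cast hd
  have hA : 0 ≤ (L : ℝ) * (((d : ℝ) - 1) * ((L : ℝ) - 1)) := mul_nonneg (by linarith) (mul_nonneg (by linarith) (by linarith))
  have hB : 0 < 64 * ((L : ℝ) * (((d : ℝ) - 1) * ((L : ℝ) - 1)) + 1) := by positivity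
  have h1 : (L : ℝ) * (((d : ℝ) - 1) * ((L : ℝ) - 1)) * δ' ≤ (L : ℝ) * (((d : ℝ) - 1) * ((L : ℝ) - 1)) * (1 / (64 * ((L : ℝ) * (((d : ℝ) - 1) * ((L : ℝ) - 1)) + 1))) :=
    mul_le_mul_of_nonneg_left hδr hA
  refine h1.trans ?_
  rw [mul_one_div, div_le_div_iff₀ hB (by norm_num : (0 : ℝ) < 64)]
  nlinarith

end Literature.MathematicalPhysics.QuantumFieldTheory.Balaban1983to89.B9Eq335SmallPlaquettesLocalData

end
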